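import Mathlib
import Literature.Computability.AlgebraicComplexity.DeterminantalConormalBoundMixed

/-!
# Crux `DetQP.DetqpSuperquadratic` (stmt-ValiantsHypothesis-0318), line `sectional-class-ladder`
# (skeleton v2, ND route) — helper for stub `stub_polarCountND`: tangent vectors of the
# kernel-incidence system at a lifted polar point

Stub `stub_polarCountND` re-runs the tree's `ncard_polarSet_le_conormalBezout_of_pencil`
(`Literature/Computability/AlgebraicComplexity/DeterminantalConormalBoundMixed.lean`,
arXiv:2606.13628 §3.1) for finite sets of NON-DEGENERATE polar points, feeding the refined
Bézout count of non-degenerate zeros (`stub_mixedBezoutNondegenerate`) instead of the count of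
isolated zeros. The new input is that the lift `z = (1 : x, u, v)` of a non-degenerate polar
point `x` is a non-degenerate zero of Sheshadri's system `Q = (chart, Â(x)v, (uᵀÂ(x))Λ, pencil)`
on `τ = (x₀ ⊔ σ) ⊔ (u ⊔ v)`: every `W = (δ₀; δx; δu; δv)` with `Σ_t ∂_t Q_j(z) W_t = 0` for all
`j` is a torus direction `(c_{blk t} z_t)_t`. This file performs the DIFFERENTIAL CALCULUS of
that statement (`kernelSystem_tangent_torus`): writing the directional derivative as the
evaluation at `z` of the derivation `D_W = Σ_t W_t ∂_t` (`MvPolynomial.mkDerivation`), the four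
families of equations linearise to
`c · δx' = 0`, `A(x) δv + E v = 0`, `(δuᵀ A(x) + uᵀ E) Λ = 0`, and the pencil equations for
`δw = (δuᵀ Aᵢ v + uᵀ Aᵢ δv)ᵢ`, where `δx' = δx − δ₀ x` and `E = Σⱼ δx'ⱼ Aⱼ`
(`D_W Â = Â(W) = δ₀ A(x) + E`). The LINEAR ALGEBRA — that these force `δx' = 0`, `δu ∈ ℂu`,
`δv ∈ ℂv` at a non-degenerate polar point (second-order Jacobi and the bordered Hessian;
`polarLift_rigidity_of_nondegenerate` in `…PolarCountNDJacobian.lean`) — enters as the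
hypothesis `hrig`, so that this file depends on the Literature only.
References: K. Sheshadri, arXiv:2606.13628 (2026), §3.1 [Sheshadri2026Border]; W. Fulton,
*Intersection Theory*, 2nd ed., 1998, Example 12.3.1 [Fulton1998].
-/

noncomputable section

-- `Summit.ValiantsHypothesis.ValiantsHypothesis.…` is the tree's mandated single-conjunct layout
-- (Sub = Summit), so the duplicated namespace component is intended.
set_option linter.dupNamespace false

namespace Summit.ValiantsHypothesis.ValiantsHypothesis.Theorems.DetQPDetqpSuperquadratic

open MvPolynomial Matrix Finset
open Literature.Computability.AlgebraicComplexity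
open Literature.Computability.AlgebraicComplexity.DeterminantalConormal
open Literature.RingTheory.MvPolynomial

/-- **Tangent vectors of the kernel-incidence system at a lifted polar point are torus
directions** (given the rigidity of the linearised system, hypothesis `hrig`): if
`D_W Q_j (z) = 0` for all equations `j` at the lift `z = (1 : x, u, v)` (`uᵀ A(x) = 0`,
`A(x) v = 0`, `c · x = 1`), then `W = (c_{blk t} z_t)_t` for the blocks `x₀, x ↦ 0`, `v ↦ 1`,
`u ↦ 2`. The proof differentiates the chart, right-kernel, reduced left-kernel and pencil
equations along `W` and reads off the linearised system fed to `hrig`.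
[cite: Sheshadri2026Border, §3.1 Steps 2–5] -/
theorem kernelSystem_tangent_torus {σ : Type} [Fintype σ] [DecidableEq σ] {m : ℕ}
    (A : Matrix (Fin (m + 1)) (Fin (m + 1)) (MvPolynomial σ ℂ))
    (hA1 : ∀ k l, (A k l).totalDegree ≤ 1) (a b c : σ → ℂ) {j₀ k₀ : σ}
    (Λ : Matrix (Fin (m + 1)) (Fin m) ℂ)
    (x0 : ((Unit ⊕ σ) ⊕ (Fin (m + 1) ⊕ Fin (m + 1))))
    (xv : σ → ((Unit ⊕ σ) ⊕ (Fin (m + 1) ⊕ Fin (m + 1))))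
    (uu vv : Fin (m + 1) → ((Unit ⊕ σ) ⊕ (Fin (m + 1) ⊕ Fin (m + 1))))
    (hx0 : x0 = Sum.inl (Sum.inl ())) (hxv : xv = fun i => Sum.inl (Sum.inr i))
    (huu : uu = fun k => Sum.inr (Sum.inl k)) (hvv : vv = fun l => Sum.inr (Sum.inr l))
    (phat : MvPolynomial σ ℂ → MvPolynomial ((Unit ⊕ σ) ⊕ (Fin (m + 1) ⊕ Fin (m + 1))) ℂ)
    (hphat : phat = fun p =>
      C (coeff 0 p) * X x0 + ∑ i, C (coeff (Finsupp.single i 1) p) * X (xv i))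
    (Ahat : Matrix (Fin (m + 1)) (Fin (m + 1))
      (MvPolynomial ((Unit ⊕ σ) ⊕ (Fin (m + 1) ⊕ Fin (m + 1))) ℂ))
    (hAhat : Ahat = A.map phat)
    (wp : σ → MvPolynomial ((Unit ⊕ σ) ⊕ (Fin (m + 1) ⊕ Fin (m + 1))) ℂ)
    (hwp : wp = fun i =>
      ∑ k, ∑ l, C (coeff (Finsupp.single i 1) (A k l)) * X (uu k) * X (vv l))
    (Q : ((Unit ⊕ Fin (m + 1)) ⊕ (Fin m ⊕ {i : σ // i ≠ j₀ ∧ i ≠ k₀})) →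
      MvPolynomial ((Unit ⊕ σ) ⊕ (Fin (m + 1) ⊕ Fin (m + 1))) ℂ)
    (hQ : Q = Sum.elim
      (Sum.elim (fun _ => X x0 - ∑ i, C (c i) * X (xv i)) (fun k => ∑ l, Ahat k l * X (vv l)))
      (Sum.elim
        (fun j => ∑ k, X (uu k) * (Ahat * Λ.map (fun r : ℂ =>
          (C r : MvPolynomial ((Unit ⊕ σ) ⊕ (Fin (m + 1) ⊕ Fin (m + 1))) ℂ))) k j)
        (fun i => C (a j₀ * b k₀ - a k₀ * b j₀) * wp i.1 -
          (C (b k₀) * wp j₀ - C (b j₀) * wp k₀) * C (a i.1) -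
          (C (a j₀) * wp k₀ - C (a k₀) * wp j₀) * C (b i.1))))
    (blk : ((Unit ⊕ σ) ⊕ (Fin (m + 1) ⊕ Fin (m + 1))) → Fin 3)
    (hblk : blk = Sum.elim (fun _ => 0) (Sum.elim (fun _ => 2) (fun _ => 1)))
    (x : σ → ℂ) (u v : Fin (m + 1) → ℂ) (huM : u ᵥ* A.map (eval x) = 0)
    (hMv : A.map (eval x) *ᵥ v = 0) (hcx : ∑ i, c i * x i = 1)
    (hrig : ∀ (δx : σ → ℂ) (δu δv : Fin (m + 1) → ℂ) (E : Matrix (Fin (m + 1)) (Fin (m + 1)) ℂ),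
      (∀ k l, E k l = ∑ j, coeff (Finsupp.single j 1) (A k l) * δx j) → ∀ δw : σ → ℂ,
      (∀ i, δw i = δu ⬝ᵥ (A.map (fun p => coeff (Finsupp.single i 1) p) *ᵥ v) +
        u ⬝ᵥ (A.map (fun p => coeff (Finsupp.single i 1) p) *ᵥ δv)) →
      ∑ i, c i * δx i = 0 → A.map (eval x) *ᵥ δv + E *ᵥ v = 0 →
      (δu ᵥ* A.map (eval x) + u ᵥ* E) ᵥ* Λ = 0 →
      (∀ i, i ≠ j₀ → i ≠ k₀ → (a j₀ * b k₀ - a k₀ * b j₀) * δw i -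
        (b k₀ * δw j₀ - b j₀ * δw k₀) * a i - (a j₀ * δw k₀ - a k₀ * δw j₀) * b i = 0) →
      δx = 0 ∧ (∃ α : ℂ, δu = α • u) ∧ (∃ β : ℂ, δv = β • v))
    (z : ((Unit ⊕ σ) ⊕ (Fin (m + 1) ⊕ Fin (m + 1))) → ℂ)
    (hz : z = Sum.elim (Sum.elim (fun _ => 1) x) (Sum.elim u v))
    (W : ((Unit ⊕ σ) ⊕ (Fin (m + 1) ⊕ Fin (m + 1))) → ℂ)
    (hW : ∀ j, eval z (mkDerivation ℂ (fun t =>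
      (C (W t) : MvPolynomial ((Unit ⊕ σ) ⊕ (Fin (m + 1) ⊕ Fin (m + 1))) ℂ)) (Q j)) = 0) :
    ∃ cc : Fin 3 → ℂ, W = fun t => cc (blk t) * z t := by
  classical
  have hphat_eval : ∀ p (y : ((Unit ⊕ σ) ⊕ (Fin (m + 1) ⊕ Fin (m + 1))) → ℂ),
      eval y (phat p) = y x0 * coeff 0 p + ∑ i, y (xv i) * coeff (Finsupp.single i 1) p := by
    intro p y
    simp only [hphat, map_add, map_sum, map_mul, eval_C, eval_X]
    rw [mul_comm]
    exact congrArg _ (Finset.sum_congr rfl fun i _ => mul_comm _ _)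
  have hzx0 : z x0 = 1 := by simp [hz, hx0]
  have hzxv : ∀ i, z (xv i) = x i := fun i => by simp [hz, hxv]
  have hzuu : ∀ k, z (uu k) = u k := fun k => by simp [hz, huu]
  have hzvv : ∀ l, z (vv l) = v l := fun l => by simp [hz, hvv]
  have hAhat_z : Ahat.map (eval z) = A.map (eval x) := by
    refine Matrix.ext fun k l => ?_
    simp only [hAhat, Matrix.map_apply, hphat_eval, hzx0, hzxv, one_mul]
    rw [eval_eq_coeff_zero_add_sum (hA1 k l)]
    exact congrArg _ (Finset.sum_congr rfl fun i _ => mul_comm _ _)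
  set DW : Derivation ℂ (MvPolynomial ((Unit ⊕ σ) ⊕ (Fin (m + 1) ⊕ Fin (m + 1))) ℂ)
      (MvPolynomial ((Unit ⊕ σ) ⊕ (Fin (m + 1) ⊕ Fin (m + 1))) ℂ) :=
    mkDerivation ℂ (fun t =>
      (C (W t) : MvPolynomial ((Unit ⊕ σ) ⊕ (Fin (m + 1) ⊕ Fin (m + 1))) ℂ)) with hDW
  -- the deformation data `(δ₀; δx'; δu; δv)` read off `W`, `E = Σ_j δx'_j A_j`
  set δ₀ : ℂ := W x0 with hδ₀
  set δx' : σ → ℂ := fun i => W (xv i) - δ₀ * x i with hδx'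
  set δu : Fin (m + 1) → ℂ := fun k => W (uu k) with hδu
  set δv : Fin (m + 1) → ℂ := fun l => W (vv l) with hδv
  set E : Matrix (Fin (m + 1)) (Fin (m + 1)) ℂ :=
    Matrix.of fun k l => ∑ j, coeff (Finsupp.single j 1) (A k l) * δx' j with hE
  set δw : σ → ℂ := fun i =>
    δu ⬝ᵥ (A.map (fun p => coeff (Finsupp.single i 1) p) *ᵥ v) +
      u ⬝ᵥ (A.map (fun p => coeff (Finsupp.single i 1) p) *ᵥ δv) with hδw
  -- derivatives of the homogenised entries: `D_W Â = Â(W) = δ₀ A(x) + E`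
  have hDphat : ∀ p, eval z (DW (phat p)) = eval W (phat p) := by
    intro p
    simp only [hphat, hDW, map_add, map_sum, Derivation.leibniz, mkDerivation_X, derivation_C,
      smul_eq_mul, mul_zero, add_zero, map_mul, eval_C, eval_X]
  have hAW : Ahat.map (eval W) = δ₀ • A.map (eval x) + E := by
    refine Matrix.ext fun k l => ?_
    simp only [Matrix.map_apply, Matrix.add_apply, Matrix.smul_apply, smul_eq_mul, hAhat, hE,
      Matrix.of_apply]
    rw [hphat_eval, eval_eq_coeff_zero_add_sum (hA1 k l)]
    have e1 : ∑ j, coeff (Finsupp.single j 1) (A k l) * δx' j =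
        ∑ j, W (xv j) * coeff (Finsupp.single j 1) (A k l) -
          δ₀ * ∑ j, coeff (Finsupp.single j 1) (A k l) * x j := by
      rw [Finset.mul_sum, ← Finset.sum_sub_distrib]
      exact Finset.sum_congr rfl fun j _ => by simp only [hδx']; ring
    rw [e1]
    ring
  have hDAhat : (Ahat.map DW).map (eval z) = δ₀ • A.map (eval x) + E := by
    rw [← hAW]
    refine Matrix.ext fun k l => ?_
    simp only [hAhat, Matrix.map_apply]
    exact hDphat _
  -- (a) the chart equation: `c · δx' = 0`
  have ha : ∑ i, c i * δx' i = 0 := by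
    have h := hW (Sum.inl (Sum.inl ()))
    have h2 : eval z (DW (Q (Sum.inl (Sum.inl ())))) = W x0 - ∑ i, c i * W (xv i) := by
      simp only [hQ, Sum.elim_inl, map_sub, map_sum, Derivation.leibniz, mkDerivation_X,
        derivation_C, smul_eq_mul, mul_zero, add_zero, map_mul, eval_C, hDW]
    rw [h2] at h
    have e1 : ∑ i, c i * δx' i = ∑ i, c i * W (xv i) - δ₀ * ∑ i, c i * x i := by
      rw [Finset.mul_sum, ← Finset.sum_sub_distrib]
      exact Finset.sum_congr rfl fun i _ => by simp only [hδx']; ring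
    rw [e1, hcx, mul_one, hδ₀]
    linear_combination -h
  -- (b) the right kernel equations: `A(x) δv + E v = 0`
  have hb : A.map (eval x) *ᵥ δv + E *ᵥ v = 0 := by
    funext k
    have h := hW (Sum.inl (Sum.inr k))
    have h2 : eval z (DW (Q (Sum.inl (Sum.inr k)))) =
        (Ahat.map (eval z) *ᵥ δv) k + ((Ahat.map DW).map (eval z) *ᵥ v) k := by
      simp only [hQ, Sum.elim_inl, Sum.elim_inr, map_sum, Derivation.leibniz, smul_eq_mul,
        map_add, map_mul, eval_X, hDW, mkDerivation_X, eval_C, mulVec, dotProduct,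
        Matrix.map_apply, hzvv, hδv]
      rw [← Finset.sum_add_distrib]
      exact Finset.sum_congr rfl fun l _ => by ring
    rw [h2, hAhat_z, hDAhat, add_mulVec, smul_mulVec, hMv, smul_zero, zero_add] at h
    rw [Pi.add_apply, Pi.zero_apply]
    exact h
  -- (c) the reduced left kernel equations: `(δuᵀ A(x) + uᵀ E) Λ = 0`
  have hc : (δu ᵥ* A.map (eval x) + u ᵥ* E) ᵥ* Λ = 0 := by
    funext j
    have h := hW (Sum.inr (Sum.inl j))
    have h2 : eval z (DW (Q (Sum.inr (Sum.inl j)))) =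
        ((δu ᵥ* Ahat.map (eval z)) ᵥ* Λ) j + ((u ᵥ* (Ahat.map DW).map (eval z)) ᵥ* Λ) j := by
      simp only [hQ, Sum.elim_inr, Sum.elim_inl, map_sum, Derivation.leibniz, smul_eq_mul,
        map_add, map_mul, eval_X, hDW, mkDerivation_X, derivation_C, eval_C, Matrix.mul_apply,
        Matrix.map_apply, mul_zero, zero_add, vecMul, dotProduct, hzuu, hδu, Finset.sum_mul,
        Finset.mul_sum]
      simp only [Finset.sum_add_distrib]
      rw [add_comm]
      refine congrArg₂ (· + ·) ?_ ?_
      · rw [Finset.sum_comm]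
        exact Finset.sum_congr rfl fun l _ => Finset.sum_congr rfl fun k _ => by ring
      · rw [Finset.sum_comm]
        exact Finset.sum_congr rfl fun l _ => Finset.sum_congr rfl fun k _ => by ring
    rw [h2, hAhat_z, hDAhat, vecMul_add, vecMul_smul, huM, smul_zero, zero_add] at h
    rw [add_vecMul, Pi.add_apply, Pi.zero_apply]
    exact h
  -- (d) the linearised pencil equations for `δw = D_W w`
  have hDwp : ∀ i, eval z (DW (wp i)) = δw i := by
    intro i
    simp only [hwp, map_sum, Derivation.leibniz, smul_eq_mul, map_add, map_mul, eval_X, eval_C,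
      hDW, mkDerivation_X, derivation_C, mul_zero, add_zero, hzuu, hzvv, hδw, hδu, hδv,
      dotProduct, mulVec, Matrix.map_apply, Finset.mul_sum]
    simp only [Finset.sum_add_distrib]
    rw [add_comm]
    refine congrArg₂ (· + ·) ?_ ?_
    · exact Finset.sum_congr rfl fun k _ => Finset.sum_congr rfl fun l _ => by ring
    · exact Finset.sum_congr rfl fun k _ => Finset.sum_congr rfl fun l _ => by ring
  have hd : ∀ i : {i : σ // i ≠ j₀ ∧ i ≠ k₀},
      (a j₀ * b k₀ - a k₀ * b j₀) * δw i.1 - (b k₀ * δw j₀ - b j₀ * δw k₀) * a i.1 -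
        (a j₀ * δw k₀ - a k₀ * δw j₀) * b i.1 = 0 := by
    intro i
    have h := hW (Sum.inr (Sum.inr i))
    have h2 : eval z (DW (Q (Sum.inr (Sum.inr i)))) =
        (a j₀ * b k₀ - a k₀ * b j₀) * δw i.1 - (b k₀ * δw j₀ - b j₀ * δw k₀) * a i.1 -
          (a j₀ * δw k₀ - a k₀ * δw j₀) * b i.1 := by
      simp only [hQ, Sum.elim_inr, Derivation.leibniz, smul_eq_mul, map_add, map_mul, map_sub,
        derivation_C, mul_zero, zero_add, add_zero, eval_C, hDwp]
      ring
    rw [h2] at h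
    exact h
  -- rigidity, and the torus form of `W`
  obtain ⟨hδx0, ⟨α, hα⟩, ⟨β, hβ⟩⟩ := hrig δx' δu δv E (fun k l => rfl) δw (fun i => rfl) ha hb hc
    (fun i hij hik => hd ⟨i, hij, hik⟩)
  refine ⟨![δ₀, β, α], funext fun t => ?_⟩
  rcases t with ((_ | i) | (k | l))
  · rw [← hx0, hzx0, mul_one]
    simp [hblk, hx0, hδ₀]
  · have e : xv i = Sum.inl (Sum.inr i) := by rw [hxv]
    have h := congrFun hδx0 i
    simp only [hδx', Pi.zero_apply, sub_eq_zero] at h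
    rw [← e, h, hzxv]
    simp [hblk, e]
  · have e : uu k = Sum.inr (Sum.inl k) := by rw [huu]
    have h := congrFun hα k
    simp only [hδu, Pi.smul_apply, smul_eq_mul] at h
    rw [← e, h, hzuu]
    simp [hblk, e]
  · have e : vv l = Sum.inr (Sum.inr l) := by rw [hvv]
    have h := congrFun hβ l
    simp only [hδv, Pi.smul_apply, smul_eq_mul] at h
    rw [← e, h, hzvv]
    simp [hblk, e]

end Summit.ValiantsHypothesis.ValiantsHypothesis.Theorems.DetQPDetqpSuperquadratic

end
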